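import Summits.Ventures.PercRepro.MSTightProj

/-!
# The slack of a projection is at most the slack ((F5) of Addendum 37, the count)

Dossier proofs/MINE1-theoremS.md, Addendum 37 (F5), and proofs/MINE1-RSTARM-PROOF.md §1 (F5).
Let `Y` be any family containing the differences of `F` (in the instance, `Y = L' ∩ C`, the faces
of `L'` below a member), and `r` an element. The differences of the partner family
`K = partner r F`, with `r` inserted, are differences of `F` containing `r`; so by
Marica–Schönheim `|K| ≤ |D(K)| ≤ #{d ∈ Y : r ∈ d}` (`card_partner_le_card_filter_mem`). With
`|F| = |proj r F| + |K|` (`card_eq_card_proj_add_card_partner`) this reads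
`#{d ∈ Y : r ∉ d} − |proj r F| ≤ |Y| − |F|` (`card_filter_sub_card_proj_le`): **the slack of the
projected data is at most the slack**, i.e. the projected data inherits (Cnt) — the counting half
of (F5). (The other half, that the projected data is an instance on the smaller ground set, is the
subtype transport of Addendum 37 §5.) The same inequality gives `|lk_r Y| ≥ |K_r|`, the
non-negativity behind «every outside vertex is a non-tightening direction».
-/

namespace PercRepro.MSTight

open Finset
open scoped FinsetFamily

variable {α : Type*} [DecidableEq α]

/-- Inserting `r` maps the differences of the partner family into the differences of `F`
containing `r`. -/
theorem insert_mem_diffs_of_mem_diffs_partner {r : α} {F : Finset (Finset α)} {d : Finset α}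
    (hd : d ∈ partner r F \\ partner r F) : insert r d ∈ F \\ F ∧ r ∉ d := by
  obtain ⟨k, hk, k', hk', rfl⟩ := mem_diffs.1 hd
  rw [partner, mem_inter] at hk hk'
  obtain ⟨hkF, hrk⟩ := mem_part0.1 hk.1
  have hrkF : insert r k ∈ F := (mem_partr.1 hk.2).2
  obtain ⟨hk'F, hrk'⟩ := mem_part0.1 hk'.1
  refine ⟨?_, fun h => hrk (mem_sdiff.1 h).1⟩
  refine mem_diffs.2 ⟨insert r k, hrkF, k', hk'F, ?_⟩
  rw [insert_sdiff_of_notMem _ hrk']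

/-- **Marica–Schönheim for the partner family inside `Y`:** if `Y` contains the differences of `F`,
then `|partner r F| ≤ #{d ∈ Y : r ∈ d}`. -/
theorem card_partner_le_card_filter_mem {r : α} {F Y : Finset (Finset α)} (hY : F \\ F ⊆ Y) :
    (partner r F).card ≤ (Y.filter fun d => r ∈ d).card := by
  calc (partner r F).card
      ≤ (partner r F \\ partner r F).card := card_le_card_diffs _
    _ = ((partner r F \\ partner r F).image fun d => insert r d).card := by
        refine (card_image_of_injOn ?_).symm
        intro d hd d' hd' h
        have h1 := (insert_mem_diffs_of_mem_diffs_partner (mem_coe.1 hd)).2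
        have h2 := (insert_mem_diffs_of_mem_diffs_partner (mem_coe.1 hd')).2
        simp only at h
        rw [← erase_insert h1, ← erase_insert h2, h]
    _ ≤ (Y.filter fun d => r ∈ d).card := by
        refine card_le_card ?_
        intro e he
        obtain ⟨d, hd, rfl⟩ := mem_image.1 he
        exact mem_filter.2 ⟨hY (insert_mem_diffs_of_mem_diffs_partner hd).1, mem_insert_self r d⟩

/-- **(F5), the count.** If `Y ⊇ F \\ F`, the slack of the projected data along `r` is at most the
slack: `#{d ∈ Y : r ∉ d} + |F| ≤ |Y| + |proj r F|`. -/
theorem card_filter_sub_card_proj_le {r : α} {F Y : Finset (Finset α)} (hY : F \\ F ⊆ Y) :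
    (Y.filter fun d => r ∉ d).card + F.card ≤ Y.card + (proj r F).card := by
  have h1 := card_eq_card_proj_add_card_partner r F
  have h2 := card_partner_le_card_filter_mem (r := r) hY
  have h3 : (Y.filter fun d => r ∈ d).card + (Y.filter fun d => ¬ (r ∈ d)).card = Y.card :=
    card_filter_add_card_filter_not (fun d => r ∈ d)
  omega

/-- The form used for (Cnt): if `|Y| ≤ |F| + 1` then `#{d ∈ Y : r ∉ d} ≤ |proj r F| + 1`. -/
theorem card_filter_le_card_proj_add_one {r : α} {F Y : Finset (Finset α)} (hY : F \\ F ⊆ Y)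
    (hcnt : Y.card ≤ F.card + 1) : (Y.filter fun d => r ∉ d).card ≤ (proj r F).card + 1 := by
  have := card_filter_sub_card_proj_le (r := r) hY
  omega

end PercRepro.MSTight
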